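import Summits.NavierStokesRegularity.NavierStokesRegularity.Theorems.QuantisedSymmetryPolyhedralDssProfileExistsStubGaussianEnstrophyIdentity
import Summits.NavierStokesRegularity.NavierStokesRegularity.Theorems.QuantisedSymmetryPolyhedralDssProfileExistsStubWeightedDivCurl
import HarnessLib

/-!
# The Gaussian energy identity of a periodic Leray orbit — crux stmt-NavierStokesRegularity-1404
  (`QuantisedSymmetry.PolyhedralDssProfileExists`), line polyhedral_cell, stub
  stub_gaussianEnergyIdentity (N28)

Registered stub `stub_gaussianEnergyIdentity` (`--supports stmt-NavierStokesRegularity-1404`).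
Let `(U, P)` be a classical solution of the backward Leray system
`∂ₛU + ½U + ½(y·∇)U + (U·∇)U + ∇P = ΔU`, `div U = 0` on `ℝ × ℝ³` (`IsBackwardLeraySolutionOn univ 1`),
`S`-periodic in `s`, with polynomial bounds on `U`, `DU`, `∂ₛU`, `P`, `∇P` (exactly the hypotheses
of the Gaussian enstrophy identity N10). With the Gaussian `w₀ = e^{−|y|²/4}`:

  `∫₀^S ∫ w₀ (P + ½|U|²)(y·U) dy ds = −2 ∫₀^S ∫ w₀ |DU|²_F dy ds − ∫₀^S ∫ w₀ |U|² dy ds`.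

Proof sketch.
* N10 (`stub_gaussianEnstrophyIdentity`): `∬ w₀ |curl U|² = −½ ∬ w₀ (P + ½|U|² + ½ y·U)(y·U)`.
* N22 (`stub_weightedDivCurl`) on every slice `U(s)` (it is `C^∞`, divergence free, with the
  polynomial bounds): `∫ w₀ |DU(s)|²_F − ∫ w₀ |curl U(s)|² = ¼ ∫ w₀ (y·U(s))² − ½ ∫ w₀ |U(s)|²`.
* Split `∫ w₀ (P + ½|U|² + ½ y·U)(y·U) = ∫ w₀ (P + ½|U|²)(y·U) + ½ ∫ w₀ (y·U)²` on every slice,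
  integrate the two slice identities over `s ∈ (0, S)` (the slice integrals are integrable in `s`
  by Fubini on `(0, S] × ℝ³`: every space–time integrand is jointly continuous — the slice Jacobian
  `(s, y) ↦ DU(s)(y)` by `IsSmoothSpaceTimeOn.isSmoothSpaceTimeOn_fderiv_of_isOpen` — and
  `O((1 + |y|)^{4N+4} w₀)`, `gaussEnstrophy_integrable_prod_of_le`), and cancel the `¼ ∬ w₀ (y·U)²`
  terms (linear arithmetic).
-/

noncomputable section

-- the summit namespace `…NavierStokesRegularity.NavierStokesRegularity…` is the tree convention (D-0017)
set_option linter.dupNamespace false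

namespace Summit.NavierStokesRegularity.NavierStokesRegularity.Theorems.PolyhedralDssProfileExists.PolyhedralCell

open MeasureTheory Set Function Filter Topology
open Literature.Analysis Literature.Analysis.FluidPDE
open scoped InnerProductSpace RealInnerProductSpace ContDiff

section Main

variable {U : ℝ → EuclideanSpace ℝ (Fin 3) → EuclideanSpace ℝ (Fin 3)}
  {P : ℝ → EuclideanSpace ℝ (Fin 3) → ℝ} {K : ℝ} {N : ℕ}

/-- **Interval integrability of the four slice functionals.** For a classical solution of the
backward Leray system on `ℝ × ℝ³` with the polynomial bounds of the stub and `0 < S`, the slice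
integrals `s ↦ ∫ w₀ |curl U(s)|²`, `s ↦ ∫ w₀ (y·U(s))²`, `s ↦ ∫ w₀ |U(s)|²` and
`s ↦ ∫ w₀ (P + ½|U|² + ½ y·U)(y·U)` are interval integrable on `[0, S]`: every space–time
integrand is jointly continuous (the slice Jacobian `(s, y) ↦ DU(s)(y)` is jointly smooth,
`IsSmoothSpaceTimeOn.isSmoothSpaceTimeOn_fderiv_of_isOpen`, and `curl U(s)(y) = curlCLM (DU(s)(y))`)
and `O((1 + |y|)^{4N+4} w₀)` (`gaussEnstrophy_bounds`, `weightedDivCurl_bounds`), hence integrable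
on `(0, S] × ℝ³` (`gaussEnstrophy_integrable_prod_of_le`), and Fubini
(`Integrable.integral_prod_left`). [folklore] -/
theorem gaussEnergy_intervalIntegrable (h : IsBackwardLeraySolutionOn Set.univ 1 U P)
    (hK : ∀ s y, ‖U s y‖ ≤ K * (1 + ‖y‖) ^ N ∧ ‖fderiv ℝ (U s) y‖ ≤ K * (1 + ‖y‖) ^ N ∧
      ‖timeDeriv U s y‖ ≤ K * (1 + ‖y‖) ^ N ∧ |P s y| ≤ K * (1 + ‖y‖) ^ N ∧
      ‖gradient (P s) y‖ ≤ K * (1 + ‖y‖) ^ N) {S : ℝ} (hS : 0 < S) :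
    IntervalIntegrable (fun s => ∫ y, gaussProfile (-(1 / 4 : ℝ)) y * ‖curl (U s) y‖ ^ 2)
        volume 0 S ∧
      IntervalIntegrable (fun s => ∫ y, gaussProfile (-(1 / 4 : ℝ)) y * ⟪y, U s y⟫ ^ 2)
        volume 0 S ∧
      IntervalIntegrable (fun s => ∫ y, gaussProfile (-(1 / 4 : ℝ)) y * ‖U s y‖ ^ 2) volume 0 S ∧
      IntervalIntegrable (fun s => ∫ y, gaussProfile (-(1 / 4 : ℝ)) y *
        ((P s y + ‖U s y‖ ^ 2 / 2 + ⟪y, U s y⟫ / 2) * ⟪y, U s y⟫)) volume 0 S := by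
  have hK2 : ∀ s y, ‖U s y‖ ≤ K * (1 + ‖y‖) ^ N ∧ ‖fderiv ℝ (U s) y‖ ≤ K * (1 + ‖y‖) ^ N :=
    fun s y => ⟨(hK s y).1, (hK s y).2.1⟩
  -- joint continuity of `U`, `P`, `DU`
  have hUst : IsSmoothSpaceTimeOn univ U := h.smooth_velocity
  have hUc : Continuous fun p : ℝ × EuclideanSpace ℝ (Fin 3) => U p.1 p.2 := by
    have h' := h.smooth_velocity
    rw [IsSmoothSpaceTimeOn, univ_prod_univ, contDiffOn_univ] at h'
    exact h'.continuous
  have hPc : Continuous fun p : ℝ × EuclideanSpace ℝ (Fin 3) => P p.1 p.2 := by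
    have h' := h.smooth_pressure
    rw [IsSmoothSpaceTimeOn, univ_prod_univ, contDiffOn_univ] at h'
    exact h'.continuous
  have hDUc : Continuous fun p : ℝ × EuclideanSpace ℝ (Fin 3) => fderiv ℝ (U p.1) p.2 := by
    have h' := hUst.isSmoothSpaceTimeOn_fderiv_of_isOpen isOpen_univ
    rw [IsSmoothSpaceTimeOn, univ_prod_univ, contDiffOn_univ] at h'
    exact h'.continuous
  have hgc : Continuous (gaussProfile (E := EuclideanSpace ℝ (Fin 3)) (-(1 / 4 : ℝ))) :=
    (contDiff_gaussProfile (E := EuclideanSpace ℝ (Fin 3)) (-(1 / 4 : ℝ)) (n := 0)).continuous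
  -- continuity of the space–time integrands
  have cA : Continuous fun p : ℝ × EuclideanSpace ℝ (Fin 3) =>
      gaussProfile (-(1 / 4 : ℝ)) p.2 * ‖curl (U p.1) p.2‖ ^ 2 := by
    have hcurl : Continuous fun p : ℝ × EuclideanSpace ℝ (Fin 3) => curl (U p.1) p.2 := by
      simp only [curl_eq_curlCLM]
      exact curlCLM.continuous.comp hDUc
    exact (hgc.comp continuous_snd).mul (hcurl.norm.pow 2)
  have cC : Continuous fun p : ℝ × EuclideanSpace ℝ (Fin 3) =>
      gaussProfile (-(1 / 4 : ℝ)) p.2 * ⟪p.2, U p.1 p.2⟫ ^ 2 :=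
    (hgc.comp continuous_snd).mul ((continuous_snd.inner hUc).pow 2)
  have cD : Continuous fun p : ℝ × EuclideanSpace ℝ (Fin 3) =>
      gaussProfile (-(1 / 4 : ℝ)) p.2 * ‖U p.1 p.2‖ ^ 2 :=
    (hgc.comp continuous_snd).mul (hUc.norm.pow 2)
  have cR : Continuous fun p : ℝ × EuclideanSpace ℝ (Fin 3) =>
      gaussProfile (-(1 / 4 : ℝ)) p.2 *
        ((P p.1 p.2 + ‖U p.1 p.2‖ ^ 2 / 2 + ⟪p.2, U p.1 p.2⟫ / 2) * ⟪p.2, U p.1 p.2⟫) :=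
    (hgc.comp continuous_snd).mul (((hPc.add ((hUc.norm.pow 2).div_const _)).add
      ((continuous_snd.inner hUc).div_const _)).mul (continuous_snd.inner hUc))
  -- integrability on `(0, S] × ℝ³`
  have hIA : Integrable (fun p : ℝ × EuclideanSpace ℝ (Fin 3) =>
      gaussProfile (-(1 / 4 : ℝ)) p.2 * ‖curl (U p.1) p.2‖ ^ 2)
      ((volume.restrict (Ioc 0 S)).prod volume) :=
    gaussEnstrophy_integrable_prod_of_le cA S fun p => (gaussEnstrophy_bounds h hK p.1 p.2).1
  have hIC : Integrable (fun p : ℝ × EuclideanSpace ℝ (Fin 3) =>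
      gaussProfile (-(1 / 4 : ℝ)) p.2 * ⟪p.2, U p.1 p.2⟫ ^ 2)
      ((volume.restrict (Ioc 0 S)).prod volume) :=
    gaussEnstrophy_integrable_prod_of_le cC S fun p =>
      (weightedDivCurl_bounds (hK2 p.1) p.2).2.2.2.2.1
  have hID : Integrable (fun p : ℝ × EuclideanSpace ℝ (Fin 3) =>
      gaussProfile (-(1 / 4 : ℝ)) p.2 * ‖U p.1 p.2‖ ^ 2)
      ((volume.restrict (Ioc 0 S)).prod volume) :=
    gaussEnstrophy_integrable_prod_of_le cD S fun p =>
      (weightedDivCurl_bounds (hK2 p.1) p.2).2.2.2.2.2.1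
  have hIR : Integrable (fun p : ℝ × EuclideanSpace ℝ (Fin 3) =>
      gaussProfile (-(1 / 4 : ℝ)) p.2 *
        ((P p.1 p.2 + ‖U p.1 p.2‖ ^ 2 / 2 + ⟪p.2, U p.1 p.2⟫ / 2) * ⟪p.2, U p.1 p.2⟫))
      ((volume.restrict (Ioc 0 S)).prod volume) :=
    gaussEnstrophy_integrable_prod_of_le cR S fun p =>
      (gaussEnstrophy_bounds h hK p.1 p.2).2.2.2.2.2.2
  exact ⟨(intervalIntegrable_iff_integrableOn_Ioc_of_le hS.le).2 hIA.integral_prod_left,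
    (intervalIntegrable_iff_integrableOn_Ioc_of_le hS.le).2 hIC.integral_prod_left,
    (intervalIntegrable_iff_integrableOn_Ioc_of_le hS.le).2 hID.integral_prod_left,
    (intervalIntegrable_iff_integrableOn_Ioc_of_le hS.le).2 hIR.integral_prod_left⟩

/-- **Splitting the right-hand side of N10 on a slice.** With the polynomial bounds (at a fixed
`s`), `∫ w₀ (P + ½|U|²)(y·U) = ∫ w₀ (P + ½|U|² + ½ y·U)(y·U) − ½ ∫ w₀ (y·U)²`, both integrands on
the right being continuous and `O((1 + |y|)^{4N+4} w₀)`, hence integrable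
(`gaussEnstrophy_integrable_of_le`). [folklore] -/
theorem gaussEnergy_slice_split (h : IsBackwardLeraySolutionOn Set.univ 1 U P)
    (hK : ∀ s y, ‖U s y‖ ≤ K * (1 + ‖y‖) ^ N ∧ ‖fderiv ℝ (U s) y‖ ≤ K * (1 + ‖y‖) ^ N ∧
      ‖timeDeriv U s y‖ ≤ K * (1 + ‖y‖) ^ N ∧ |P s y| ≤ K * (1 + ‖y‖) ^ N ∧
      ‖gradient (P s) y‖ ≤ K * (1 + ‖y‖) ^ N) (s : ℝ) :
    ∫ y, gaussProfile (-(1 / 4 : ℝ)) y * ((P s y + ‖U s y‖ ^ 2 / 2) * ⟪y, U s y⟫) =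
      (∫ y, gaussProfile (-(1 / 4 : ℝ)) y *
          ((P s y + ‖U s y‖ ^ 2 / 2 + ⟪y, U s y⟫ / 2) * ⟪y, U s y⟫)) -
        (1 / 2 : ℝ) * ∫ y, gaussProfile (-(1 / 4 : ℝ)) y * ⟪y, U s y⟫ ^ 2 := by
  have hK2 : ∀ y, ‖U s y‖ ≤ K * (1 + ‖y‖) ^ N ∧ ‖fderiv ℝ (U s) y‖ ≤ K * (1 + ‖y‖) ^ N :=
    fun y => ⟨(hK s y).1, (hK s y).2.1⟩
  have hU : ContDiff ℝ ∞ (U s) := h.contDiff_velocity (mem_univ s)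
  have hP : ContDiff ℝ ∞ (P s) := h.contDiff_pressure (mem_univ s)
  have hgc : Continuous (gaussProfile (E := EuclideanSpace ℝ (Fin 3)) (-(1 / 4 : ℝ))) :=
    (contDiff_gaussProfile (E := EuclideanSpace ℝ (Fin 3)) (-(1 / 4 : ℝ)) (n := 0)).continuous
  have cR : Continuous fun y =>
      gaussProfile (-(1 / 4 : ℝ)) y * ((P s y + ‖U s y‖ ^ 2 / 2 + ⟪y, U s y⟫ / 2) * ⟪y, U s y⟫) :=
    hgc.mul (((hP.continuous.add ((hU.continuous.norm.pow 2).div_const _)).add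
      ((continuous_id'.inner hU.continuous).div_const _)).mul (continuous_id'.inner hU.continuous))
  have cC : Continuous fun y => gaussProfile (-(1 / 4 : ℝ)) y * ⟪y, U s y⟫ ^ 2 :=
    hgc.mul ((continuous_id'.inner hU.continuous).pow 2)
  have iR : Integrable fun y =>
      gaussProfile (-(1 / 4 : ℝ)) y * ((P s y + ‖U s y‖ ^ 2 / 2 + ⟪y, U s y⟫ / 2) * ⟪y, U s y⟫) :=
    gaussEnstrophy_integrable_of_le cR fun y => (gaussEnstrophy_bounds h hK s y).2.2.2.2.2.2
  have iC : Integrable fun y => gaussProfile (-(1 / 4 : ℝ)) y * ⟪y, U s y⟫ ^ 2 :=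
    gaussEnstrophy_integrable_of_le cC fun y => (weightedDivCurl_bounds hK2 y).2.2.2.2.1
  rw [← integral_const_mul, ← integral_sub iR (iC.const_mul _)]
  congr 1
  funext y
  ring

/-! ### The registered stub -/

/-- **Stub N28 — the Gaussian ENERGY identity of a periodic backward-Leray orbit.** Let `(U, P)`
be a classical solution of the backward Leray system `∂ₛU + ½U + ½(y·∇)U + (U·∇)U + ∇P = ΔU`,
`div U = 0` on `ℝ × ℝ³`, `S`-periodic in `s` (`S > 0`), with polynomial bounds on `U`, `DU`,
`∂ₛU`, `P`, `∇P`. Then, with `w₀(y) = e^{−|y|²/4}`,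
`∫₀^S ∫ w₀ (P + ½|U|²)(y·U) dy ds = −2 ∫₀^S ∫ w₀ |DU|²_F dy ds − ∫₀^S ∫ w₀ |U|² dy ds`:
the Gaussian enstrophy identity N10, `∬ w₀ |curl U|² = −½ ∬ w₀ (P + ½|U|² + ½ y·U)(y·U)`,
combined with the kinematic weighted div–curl identity N22 on every slice,
`∫ w₀ |DU(s)|²_F − ∫ w₀ |curl U(s)|² = ¼ ∫ w₀ (y·U(s))² − ½ ∫ w₀ |U(s)|²`, integrated over
`s ∈ (0, S)` (`gaussEnergy_intervalIntegrable`); the `¼ ∬ w₀ (y·U)²` terms cancel. It is the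
`L²(w₀)` energy balance of the orbit over a period: the damping `−∬ w₀ |DU|²_F − ½ ∬ w₀ |U|²` is
compensated by the inward Gaussian flux of the Bernoulli pressure `P + ½|U|²`.
[cite: PineauVicol2026, (5.4) (p. 13)] -/
theorem stub_gaussianEnergyIdentity :
    ∀ (U : ℝ → EuclideanSpace ℝ (Fin 3) → EuclideanSpace ℝ (Fin 3)) (P : ℝ → EuclideanSpace ℝ (Fin 3) → ℝ)
      (S : ℝ), 0 < S → IsBackwardLeraySolutionOn Set.univ 1 U P → Function.Periodic U S →
      (∃ K : ℝ, ∃ N : ℕ, ∀ s y,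
          ‖U s y‖ ≤ K * (1 + ‖y‖) ^ N ∧ ‖fderiv ℝ (U s) y‖ ≤ K * (1 + ‖y‖) ^ N ∧
          ‖timeDeriv U s y‖ ≤ K * (1 + ‖y‖) ^ N ∧ |P s y| ≤ K * (1 + ‖y‖) ^ N ∧
          ‖gradient (P s) y‖ ≤ K * (1 + ‖y‖) ^ N) →
      ∫ s in (0 : ℝ)..S, ∫ y, Real.exp (-‖y‖ ^ 2 / 4) * ((P s y + ‖U s y‖ ^ 2 / 2) * ⟪y, U s y⟫_ℝ) =
        -(2 : ℝ) * (∫ s in (0 : ℝ)..S, ∫ y, Real.exp (-‖y‖ ^ 2 / 4) * frobeniusNormSq (fderiv ℝ (U s) y)) -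
          ∫ s in (0 : ℝ)..S, ∫ y, Real.exp (-‖y‖ ^ 2 / 4) * ‖U s y‖ ^ 2 := by
  intro U P S hS h hper hbd
  -- N10, with the very same hypotheses
  have hN10 := stub_gaussianEnstrophyIdentity U P S hS h hper hbd
  obtain ⟨K, N, hK⟩ := hbd
  -- the weight is the tree's `gaussProfile (−1/4)`
  have hw0 : ∀ y : EuclideanSpace ℝ (Fin 3),
      Real.exp (-‖y‖ ^ 2 / 4) = gaussProfile (-(1 / 4 : ℝ)) y := fun y => by
    simp only [gaussProfile]
    congr 1
    ring
  simp only [hw0] at hN10 ⊢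
  -- N22 on every slice
  have hK2 : ∀ s y, ‖U s y‖ ≤ K * (1 + ‖y‖) ^ N ∧ ‖fderiv ℝ (U s) y‖ ≤ K * (1 + ‖y‖) ^ N :=
    fun s y => ⟨(hK s y).1, (hK s y).2.1⟩
  have hN22 : ∀ s, (∫ y, gaussProfile (-(1 / 4 : ℝ)) y * frobeniusNormSq (fderiv ℝ (U s) y)) -
      ∫ y, gaussProfile (-(1 / 4 : ℝ)) y * ‖curl (U s) y‖ ^ 2 =
        (1 / 4 : ℝ) * (∫ y, gaussProfile (-(1 / 4 : ℝ)) y * ⟪y, U s y⟫ ^ 2) -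
          (1 / 2 : ℝ) * ∫ y, gaussProfile (-(1 / 4 : ℝ)) y * ‖U s y‖ ^ 2 := by
    intro s
    have hU2 : ContDiff ℝ 2 (U s) := (h.contDiff_velocity (mem_univ s)).of_le (by norm_cast)
    have h22 := stub_weightedDivCurl (U s) hU2 (h.divFree s (mem_univ s)) ⟨K, N, hK2 s⟩
    simpa only [hw0] using h22
  -- integrate the two slice identities over `[0, S]`
  obtain ⟨hiA, hiC, hiD, hiR⟩ := gaussEnergy_intervalIntegrable h hK hS
  have e1 : ∫ s in (0 : ℝ)..S, ∫ y, gaussProfile (-(1 / 4 : ℝ)) y * frobeniusNormSq (fderiv ℝ (U s) y) =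
      ∫ s in (0 : ℝ)..S, ((∫ y, gaussProfile (-(1 / 4 : ℝ)) y * ‖curl (U s) y‖ ^ 2) +
        ((1 / 4 : ℝ) * (∫ y, gaussProfile (-(1 / 4 : ℝ)) y * ⟪y, U s y⟫ ^ 2) -
          (1 / 2 : ℝ) * ∫ y, gaussProfile (-(1 / 4 : ℝ)) y * ‖U s y‖ ^ 2)) :=
    intervalIntegral.integral_congr fun s _ => by linarith [hN22 s]
  rw [intervalIntegral.integral_add hiA ((hiC.const_mul _).sub (hiD.const_mul _)),
    intervalIntegral.integral_sub (hiC.const_mul _) (hiD.const_mul _),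
    intervalIntegral.integral_const_mul, intervalIntegral.integral_const_mul] at e1
  have e2 : ∫ s in (0 : ℝ)..S, ∫ y, gaussProfile (-(1 / 4 : ℝ)) y *
      ((P s y + ‖U s y‖ ^ 2 / 2) * ⟪y, U s y⟫) =
      ∫ s in (0 : ℝ)..S, ((∫ y, gaussProfile (-(1 / 4 : ℝ)) y *
          ((P s y + ‖U s y‖ ^ 2 / 2 + ⟪y, U s y⟫ / 2) * ⟪y, U s y⟫)) -
        (1 / 2 : ℝ) * ∫ y, gaussProfile (-(1 / 4 : ℝ)) y * ⟪y, U s y⟫ ^ 2) :=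
    intervalIntegral.integral_congr fun s _ => gaussEnergy_slice_split h hK s
  rw [intervalIntegral.integral_sub hiR (hiC.const_mul _), intervalIntegral.integral_const_mul] at e2
  rw [e2, e1]
  linarith [hN10]

end Main

end Summit.NavierStokesRegularity.NavierStokesRegularity.Theorems.PolyhedralDssProfileExists.PolyhedralCell

end
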